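import Summits.QuantumFields.GaugeBoot.Rung0D4SU3LoopEqs
import HarnessLib

/-!
# Gauge-boot rung-0 truncation, `D = 4`, `SU(3)`: the three equality rows (companion of `Rung0D4SU3LoopEqs.lean`)

Cell `pub-gaugeboot`, seat lean2 (task L1 lane).  HONEST FRAMING: certified bounds on lattice expectations at STATED coupling,
gauge group, dimension and torus size; NOT a mass gap, NOT a continuum limit, NOT a string tension, NOT large `N`; NOT
Yang–Mills-summit-bearing (barriers `FixedCouplingUltralocality`, `PerturbativeInvisibility`).  NO bound, NO certificate, NO
index row, NO `CERTIFIED` cell.  `Rung0D4SU3LoopEqs.lean` carries every raw term of the single-link Schwinger–Dyson identity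
(`loopEquation_pairForm_su_three` at the marked plaquette and at the spur word, `d = 4`) to the labels of the sixteen problem
files `certs/SU3-D4/rung0/beta-*.problem1.json` (rows B38–B53); this module assembles the three `eq_rows` VERBATIM (variables
written out in full; `w⟦C⟧` / `d⟦A, x, B⟧` in the docstrings are shorthand for `wilsonExpectation (fundamentalRep (Fin 3)) (β/3)
(wordLoop … 0 C)` and `(∫ tr hol_0 A · tr hol_x B ∂μ_{β/3}).re / 9`, `β = β_std`):
`sdRow_plaquette` (`L ≥ 3`; eq_rows[0], 1/λ = β/18), `spurRow_raw` / `spurRow` (`L ≥ 4`; `β ≠ 0` for the printed form),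
`newtonRow` (eq_rows[2]).  Everything is `[folklore]`.
-/

noncomputable section

open MeasureTheory
open scoped Matrix ComplexConjugate
open Literature.MathematicalPhysics.QuantumFieldTheory
open Literature.MathematicalPhysics.QuantumLattice

namespace Summit.QuantumFields.GaugeBoot

namespace Rung0D4SU3

variable (β : ℝ) (L : ℕ) [NeZero L]

/-! ## The three equality rows -/

/-- **`eq_rows[0]` — the single-link Schwinger–Dyson row of the marked plaquette, VERBATIM** (lattice `SU(3)` on
`(ℤ/L)^4`, every `L ≥ 3`, every real standard coupling `β`; at `β = 1` the printed coefficients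
`{0: −1/18, 1: 8/9, 2: −1/18, 3: −2/9, 7: 1/18, 9: 1/18, 10: 2/9, 13: 1/18, 14: −1/18, 16: −1/18, 17: 1/18, 20: 2/9, 21: −2/9}`
of `certs/SU3-D4/rung0/beta-1-1.problem1.json`). [folklore] -/
theorem sdRow_plaquette (hL : 3 ≤ L) :
    -(β / 18)
      + 8 / 9 * wilsonExpectation (d := 4) (L := L) (fundamentalRep (Fin 3)) (β / 3) (wordLoop (fundamentalRep (Fin 3)) (0 : Site 4 L) ([.fwd 0, .fwd 1, .bwd 0, .bwd 1] : Word 4))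
      - β / 18 * wilsonExpectation (d := 4) (L := L) (fundamentalRep (Fin 3)) (β / 3) (wordLoop (fundamentalRep (Fin 3)) (0 : Site 4 L) ([.fwd 0, .fwd 0, .fwd 1, .bwd 0, .bwd 0, .bwd 1] : Word 4))
      - 2 * β / 9 * wilsonExpectation (d := 4) (L := L) (fundamentalRep (Fin 3)) (β / 3) (wordLoop (fundamentalRep (Fin 3)) (0 : Site 4 L) ([.fwd 0, .fwd 1, .bwd 0, .fwd 2, .bwd 1, .bwd 2] : Word 4))
      + β / 18 * wilsonExpectation (d := 4) (L := L) (fundamentalRep (Fin 3)) (β / 3) (wordLoop (fundamentalRep (Fin 3)) (0 : Site 4 L) ([.fwd 0, .fwd 1, .fwd 0, .bwd 1, .bwd 0, .fwd 1, .bwd 0, .bwd 1] : Word 4))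
      + β / 18 * wilsonExpectation (d := 4) (L := L) (fundamentalRep (Fin 3)) (β / 3) (wordLoop (fundamentalRep (Fin 3)) (0 : Site 4 L) ([.fwd 0, .fwd 1, .bwd 0, .bwd 1, .fwd 0, .fwd 1, .bwd 0, .bwd 1] : Word 4))
      + 2 * β / 9 * wilsonExpectation (d := 4) (L := L) (fundamentalRep (Fin 3)) (β / 3) (wordLoop (fundamentalRep (Fin 3)) (0 : Site 4 L) ([.fwd 0, .fwd 1, .bwd 0, .bwd 1, .fwd 0, .fwd 2, .bwd 0, .bwd 2] : Word 4))
      + β / 18 * (∫ U, (fundamentalRep (Fin 3) (wordHolonomy U (0 : Site 4 L) ([.fwd 0, .fwd 1, .bwd 0, .bwd 1] : Word 4))).trace * (fundamentalRep (Fin 3) (wordHolonomy U (castZ ![-1, 0, 0, 0]) ([.fwd 0, .fwd 1, .bwd 0, .bwd 1] : Word 4))).trace ∂(wilsonMeasure (d := 4) (L := L) (fundamentalRep (Fin 3)) (β / 3))).re / 9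
      - β / 18 * (∫ U, (fundamentalRep (Fin 3) (wordHolonomy U (0 : Site 4 L) ([.fwd 0, .fwd 1, .bwd 0, .bwd 1] : Word 4))).trace * (fundamentalRep (Fin 3) (wordHolonomy U (0 : Site 4 L) ([.fwd 0, .fwd 1, .bwd 0, .bwd 1] : Word 4))).trace ∂(wilsonMeasure (d := 4) (L := L) (fundamentalRep (Fin 3)) (β / 3))).re / 9
      - β / 18 * (∫ U, (fundamentalRep (Fin 3) (wordHolonomy U (0 : Site 4 L) ([.fwd 0, .fwd 1, .bwd 0, .bwd 1] : Word 4))).trace * (fundamentalRep (Fin 3) (wordHolonomy U (castZ ![-1, 1, 0, 0]) ([.fwd 0, .bwd 1, .bwd 0, .fwd 1] : Word 4))).trace ∂(wilsonMeasure (d := 4) (L := L) (fundamentalRep (Fin 3)) (β / 3))).re / 9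
      + β / 18 * (∫ U, (fundamentalRep (Fin 3) (wordHolonomy U (0 : Site 4 L) ([.fwd 0, .fwd 1, .bwd 0, .bwd 1] : Word 4))).trace * (fundamentalRep (Fin 3) (wordHolonomy U (castZ ![0, 1, 0, 0]) ([.fwd 0, .bwd 1, .bwd 0, .fwd 1] : Word 4))).trace ∂(wilsonMeasure (d := 4) (L := L) (fundamentalRep (Fin 3)) (β / 3))).re / 9
      + 2 * β / 9 * (∫ U, (fundamentalRep (Fin 3) (wordHolonomy U (0 : Site 4 L) ([.fwd 0, .fwd 1, .bwd 0, .bwd 1] : Word 4))).trace * (fundamentalRep (Fin 3) (wordHolonomy U (castZ ![0, 0, -1, 0]) ([.fwd 0, .fwd 2, .bwd 0, .bwd 2] : Word 4))).trace ∂(wilsonMeasure (d := 4) (L := L) (fundamentalRep (Fin 3)) (β / 3))).re / 9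
      - 2 * β / 9 * (∫ U, (fundamentalRep (Fin 3) (wordHolonomy U (0 : Site 4 L) ([.fwd 0, .fwd 1, .bwd 0, .bwd 1] : Word 4))).trace * (fundamentalRep (Fin 3) (wordHolonomy U (0 : Site 4 L) ([.fwd 0, .fwd 2, .bwd 0, .bwd 2] : Word 4))).trace ∂(wilsonMeasure (d := 4) (L := L) (fundamentalRep (Fin 3)) (β / 3))).re / 9
      = 0 := by
  have hocc : ((Finset.range 4).filter ((Word.plaquette (0 : Fin 4) 1).fwdOccZ 0)) = {0} ∧
      ((Finset.range 4).filter ((Word.plaquette (0 : Fin 4) 1).bwdOccZ 0)) = ∅ ∧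
      (Word.plaquette (0 : Fin 4) 1).DispBound 1 ∧ Word.disp (Word.plaquette (0 : Fin 4) 1) = 0 := by decide
  have h := loopEquation_pairForm_su_three (L := L) (β / 3) (0 : Site 4 L) 0 (Word.plaquette (0 : Fin 4) 1)
    (Word.endpoint_eq_self_of_disp _ hocc.2.2.2) (Word.small_of_dispBound hocc.2.2.1 (by omega))
  rw [Word.length_plaquette, hocc.1, hocc.2.1, Finset.sum_singleton, Finset.sum_empty, List.take_zero, List.drop_zero,
    re_integral_trace_nil_mul_trace_su_three, univ_erase_zero_fin_four, Finset.sum_insert (by decide), Finset.sum_pair (by decide)] at h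
  simp only [Fintype.sum_bool, W_plaq_self, W_plaq_1_true_P, W_plaq_1_true_Prev, W_plaq_1_false_P, W_plaq_1_false_Prev, W_plaq_2_true_P, W_plaq_2_true_Prev, W_plaq_2_false_P, W_plaq_2_false_Prev, W_plaq_3_true_P, W_plaq_3_true_Prev, W_plaq_3_false_P, W_plaq_3_false_Prev,
    D_plaq_1_true_P, D_plaq_1_true_Prev, D_plaq_1_false_P, D_plaq_1_false_Prev, D_plaq_2_true_P, D_plaq_2_true_Prev, D_plaq_2_false_P, D_plaq_2_false_Prev, D_plaq_3_true_P, D_plaq_3_true_Prev, D_plaq_3_false_P, D_plaq_3_false_Prev, W_nil] at h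
  linear_combination h

/-- **`eq_rows[1]` with its factor `1/λ = β/18` — the spur row** `+0 · Q · −0` (every `L ≥ 4`, every real `β`): the two
traversals of the marked link cancel (`D([], w) = D(w, []) = w(w)`), the plaquette insertions remain. [folklore] -/
theorem spurRow_raw (hL : 4 ≤ L) :
    β / 18 * (
      wilsonExpectation (d := 4) (L := L) (fundamentalRep (Fin 3)) (β / 3) (wordLoop (fundamentalRep (Fin 3)) (0 : Site 4 L) ([.fwd 0, .fwd 0, .fwd 1, .bwd 0, .bwd 0, .bwd 1] : Word 4))
        + wilsonExpectation (d := 4) (L := L) (fundamentalRep (Fin 3)) (β / 3) (wordLoop (fundamentalRep (Fin 3)) (0 : Site 4 L) ([.fwd 0, .fwd 0, .fwd 1, .bwd 0, .bwd 1, .bwd 1, .bwd 0, .fwd 1] : Word 4))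
        + 4 * wilsonExpectation (d := 4) (L := L) (fundamentalRep (Fin 3)) (β / 3) (wordLoop (fundamentalRep (Fin 3)) (0 : Site 4 L) ([.fwd 0, .fwd 0, .fwd 1, .bwd 0, .bwd 1, .fwd 2, .bwd 0, .bwd 2] : Word 4))
        - wilsonExpectation (d := 4) (L := L) (fundamentalRep (Fin 3)) (β / 3) (wordLoop (fundamentalRep (Fin 3)) (0 : Site 4 L) ([.fwd 0, .fwd 1, .fwd 0, .fwd 1, .bwd 0, .bwd 1, .bwd 0, .bwd 1] : Word 4))
        - wilsonExpectation (d := 4) (L := L) (fundamentalRep (Fin 3)) (β / 3) (wordLoop (fundamentalRep (Fin 3)) (0 : Site 4 L) ([.fwd 0, .fwd 1, .fwd 0, .bwd 1, .bwd 0, .fwd 1, .bwd 0, .bwd 1] : Word 4))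
        - 4 * wilsonExpectation (d := 4) (L := L) (fundamentalRep (Fin 3)) (β / 3) (wordLoop (fundamentalRep (Fin 3)) (0 : Site 4 L) ([.fwd 0, .fwd 1, .fwd 0, .bwd 1, .bwd 0, .fwd 2, .bwd 0, .bwd 2] : Word 4))
        + (∫ U, (fundamentalRep (Fin 3) (wordHolonomy U (0 : Site 4 L) ([.fwd 0, .fwd 1, .bwd 0, .bwd 1] : Word 4))).trace * (fundamentalRep (Fin 3) (wordHolonomy U (castZ ![-1, -1, 0, 0]) ([.fwd 0, .fwd 1, .bwd 0, .bwd 1] : Word 4))).trace ∂(wilsonMeasure (d := 4) (L := L) (fundamentalRep (Fin 3)) (β / 3))).re / 9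
        - (∫ U, (fundamentalRep (Fin 3) (wordHolonomy U (0 : Site 4 L) ([.fwd 0, .fwd 1, .bwd 0, .bwd 1] : Word 4))).trace * (fundamentalRep (Fin 3) (wordHolonomy U (castZ ![-1, 0, 0, 0]) ([.fwd 0, .fwd 1, .bwd 0, .bwd 1] : Word 4))).trace ∂(wilsonMeasure (d := 4) (L := L) (fundamentalRep (Fin 3)) (β / 3))).re / 9
        - (∫ U, (fundamentalRep (Fin 3) (wordHolonomy U (0 : Site 4 L) ([.fwd 0, .fwd 1, .bwd 0, .bwd 1] : Word 4))).trace * (fundamentalRep (Fin 3) (wordHolonomy U (castZ ![-1, 0, 0, 0]) ([.fwd 0, .bwd 1, .bwd 0, .fwd 1] : Word 4))).trace ∂(wilsonMeasure (d := 4) (L := L) (fundamentalRep (Fin 3)) (β / 3))).re / 9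
        + (∫ U, (fundamentalRep (Fin 3) (wordHolonomy U (0 : Site 4 L) ([.fwd 0, .fwd 1, .bwd 0, .bwd 1] : Word 4))).trace * (fundamentalRep (Fin 3) (wordHolonomy U (castZ ![-1, 1, 0, 0]) ([.fwd 0, .bwd 1, .bwd 0, .fwd 1] : Word 4))).trace ∂(wilsonMeasure (d := 4) (L := L) (fundamentalRep (Fin 3)) (β / 3))).re / 9
        + 4 * (∫ U, (fundamentalRep (Fin 3) (wordHolonomy U (0 : Site 4 L) ([.fwd 0, .fwd 1, .bwd 0, .bwd 1] : Word 4))).trace * (fundamentalRep (Fin 3) (wordHolonomy U (castZ ![-1, 0, -1, 0]) ([.fwd 0, .fwd 2, .bwd 0, .bwd 2] : Word 4))).trace ∂(wilsonMeasure (d := 4) (L := L) (fundamentalRep (Fin 3)) (β / 3))).re / 9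
        - 4 * (∫ U, (fundamentalRep (Fin 3) (wordHolonomy U (0 : Site 4 L) ([.fwd 0, .fwd 1, .bwd 0, .bwd 1] : Word 4))).trace * (fundamentalRep (Fin 3) (wordHolonomy U (castZ ![-1, 0, 0, 0]) ([.fwd 0, .fwd 2, .bwd 0, .bwd 2] : Word 4))).trace ∂(wilsonMeasure (d := 4) (L := L) (fundamentalRep (Fin 3)) (β / 3))).re / 9)
      = 0 := by
  have hocc : ((Finset.range 6).filter ((Word.spurPlaquette (0 : Fin 4) 1).fwdOccZ 0)) = {0} ∧
      ((Finset.range 6).filter ((Word.spurPlaquette (0 : Fin 4) 1).bwdOccZ 0)) = {5} ∧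
      (Word.spurPlaquette (0 : Fin 4) 1).DispBound 2 ∧ Word.disp (Word.spurPlaquette (0 : Fin 4) 1) = 0 ∧
      (Word.spurPlaquette (0 : Fin 4) 1).take (5 + 1) = Word.spurPlaquette 0 1 ∧
      (Word.spurPlaquette (0 : Fin 4) 1).drop (5 + 1) = [] := by decide
  have h := loopEquation_pairForm_su_three (L := L) (β / 3) (0 : Site 4 L) 0 (Word.spurPlaquette (0 : Fin 4) 1)
    (Word.endpoint_eq_self_of_disp _ hocc.2.2.2.1) (Word.small_of_dispBound hocc.2.2.1 (by omega))
  rw [Word.length_spurPlaquette, hocc.1, hocc.2.1, Finset.sum_singleton, Finset.sum_singleton, List.take_zero,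
    List.drop_zero, hocc.2.2.2.2.1, hocc.2.2.2.2.2, re_integral_trace_nil_mul_trace_su_three, D_nil_right,
    univ_erase_zero_fin_four, Finset.sum_insert (by decide), Finset.sum_pair (by decide)] at h
  simp only [Fintype.sum_bool, W_spur_self, W_spur_1_true_P, W_spur_1_true_Prev, W_spur_1_false_P, W_spur_1_false_Prev, W_spur_2_true_P, W_spur_2_true_Prev, W_spur_2_false_P, W_spur_2_false_Prev, W_spur_3_true_P, W_spur_3_true_Prev, W_spur_3_false_P, W_spur_3_false_Prev,
    D_spur_1_true_P, D_spur_1_true_Prev, D_spur_1_false_P, D_spur_1_false_Prev, D_spur_2_true_P, D_spur_2_true_Prev, D_spur_2_false_P, D_spur_2_false_Prev, D_spur_3_true_P, D_spur_3_true_Prev, D_spur_3_false_P, D_spur_3_false_Prev] at h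
  linear_combination h

/-- **`eq_rows[1]` VERBATIM** (`β ≠ 0`, `L ≥ 4`; printed coefficients
`{2: 1, 4: 1, 5: 4, 6: −1, 7: −1, 8: −4, 12: 1, 13: −1, 15: −1, 16: 1, 18: 4, 19: −4}` of every
`certs/SU3-D4/rung0/beta-*.problem1.json`). [folklore] -/
theorem spurRow (hβ : β ≠ 0) (hL : 4 ≤ L) :
    wilsonExpectation (d := 4) (L := L) (fundamentalRep (Fin 3)) (β / 3) (wordLoop (fundamentalRep (Fin 3)) (0 : Site 4 L) ([.fwd 0, .fwd 0, .fwd 1, .bwd 0, .bwd 0, .bwd 1] : Word 4))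
      + wilsonExpectation (d := 4) (L := L) (fundamentalRep (Fin 3)) (β / 3) (wordLoop (fundamentalRep (Fin 3)) (0 : Site 4 L) ([.fwd 0, .fwd 0, .fwd 1, .bwd 0, .bwd 1, .bwd 1, .bwd 0, .fwd 1] : Word 4))
      + 4 * wilsonExpectation (d := 4) (L := L) (fundamentalRep (Fin 3)) (β / 3) (wordLoop (fundamentalRep (Fin 3)) (0 : Site 4 L) ([.fwd 0, .fwd 0, .fwd 1, .bwd 0, .bwd 1, .fwd 2, .bwd 0, .bwd 2] : Word 4))
      - wilsonExpectation (d := 4) (L := L) (fundamentalRep (Fin 3)) (β / 3) (wordLoop (fundamentalRep (Fin 3)) (0 : Site 4 L) ([.fwd 0, .fwd 1, .fwd 0, .fwd 1, .bwd 0, .bwd 1, .bwd 0, .bwd 1] : Word 4))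
      - wilsonExpectation (d := 4) (L := L) (fundamentalRep (Fin 3)) (β / 3) (wordLoop (fundamentalRep (Fin 3)) (0 : Site 4 L) ([.fwd 0, .fwd 1, .fwd 0, .bwd 1, .bwd 0, .fwd 1, .bwd 0, .bwd 1] : Word 4))
      - 4 * wilsonExpectation (d := 4) (L := L) (fundamentalRep (Fin 3)) (β / 3) (wordLoop (fundamentalRep (Fin 3)) (0 : Site 4 L) ([.fwd 0, .fwd 1, .fwd 0, .bwd 1, .bwd 0, .fwd 2, .bwd 0, .bwd 2] : Word 4))
      + (∫ U, (fundamentalRep (Fin 3) (wordHolonomy U (0 : Site 4 L) ([.fwd 0, .fwd 1, .bwd 0, .bwd 1] : Word 4))).trace * (fundamentalRep (Fin 3) (wordHolonomy U (castZ ![-1, -1, 0, 0]) ([.fwd 0, .fwd 1, .bwd 0, .bwd 1] : Word 4))).trace ∂(wilsonMeasure (d := 4) (L := L) (fundamentalRep (Fin 3)) (β / 3))).re / 9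
      - (∫ U, (fundamentalRep (Fin 3) (wordHolonomy U (0 : Site 4 L) ([.fwd 0, .fwd 1, .bwd 0, .bwd 1] : Word 4))).trace * (fundamentalRep (Fin 3) (wordHolonomy U (castZ ![-1, 0, 0, 0]) ([.fwd 0, .fwd 1, .bwd 0, .bwd 1] : Word 4))).trace ∂(wilsonMeasure (d := 4) (L := L) (fundamentalRep (Fin 3)) (β / 3))).re / 9
      - (∫ U, (fundamentalRep (Fin 3) (wordHolonomy U (0 : Site 4 L) ([.fwd 0, .fwd 1, .bwd 0, .bwd 1] : Word 4))).trace * (fundamentalRep (Fin 3) (wordHolonomy U (castZ ![-1, 0, 0, 0]) ([.fwd 0, .bwd 1, .bwd 0, .fwd 1] : Word 4))).trace ∂(wilsonMeasure (d := 4) (L := L) (fundamentalRep (Fin 3)) (β / 3))).re / 9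
      + (∫ U, (fundamentalRep (Fin 3) (wordHolonomy U (0 : Site 4 L) ([.fwd 0, .fwd 1, .bwd 0, .bwd 1] : Word 4))).trace * (fundamentalRep (Fin 3) (wordHolonomy U (castZ ![-1, 1, 0, 0]) ([.fwd 0, .bwd 1, .bwd 0, .fwd 1] : Word 4))).trace ∂(wilsonMeasure (d := 4) (L := L) (fundamentalRep (Fin 3)) (β / 3))).re / 9
      + 4 * (∫ U, (fundamentalRep (Fin 3) (wordHolonomy U (0 : Site 4 L) ([.fwd 0, .fwd 1, .bwd 0, .bwd 1] : Word 4))).trace * (fundamentalRep (Fin 3) (wordHolonomy U (castZ ![-1, 0, -1, 0]) ([.fwd 0, .fwd 2, .bwd 0, .bwd 2] : Word 4))).trace ∂(wilsonMeasure (d := 4) (L := L) (fundamentalRep (Fin 3)) (β / 3))).re / 9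
      - 4 * (∫ U, (fundamentalRep (Fin 3) (wordHolonomy U (0 : Site 4 L) ([.fwd 0, .fwd 1, .bwd 0, .bwd 1] : Word 4))).trace * (fundamentalRep (Fin 3) (wordHolonomy U (castZ ![-1, 0, 0, 0]) ([.fwd 0, .fwd 2, .bwd 0, .bwd 2] : Word 4))).trace ∂(wilsonMeasure (d := 4) (L := L) (fundamentalRep (Fin 3)) (β / 3))).re / 9
      = 0 := by
  have h := spurRow_raw β L hL
  have h18 : β / 18 ≠ 0 := div_ne_zero hβ (by norm_num)
  have h' := (mul_eq_zero.1 h).resolve_left h18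
  linear_combination h'

/-- **`eq_rows[2]` VERBATIM — the Newton row** (`SU(3)` Cayley–Hamilton, every `L ≥ 1`, every real `β`; printed
coefficients `{1: −2/3, 9: −1/3, 14: 1}`): `−2/3·w[abAB] − 1/3·w[abABabAB] + d[abAB@0; abAB@0] = 0`
(`SU3KinematicalRows.su3_newton_row_plaquette`). [folklore] -/
theorem newtonRow :
    -2 / 3 * wilsonExpectation (d := 4) (L := L) (fundamentalRep (Fin 3)) (β / 3) (wordLoop (fundamentalRep (Fin 3)) (0 : Site 4 L) ([.fwd 0, .fwd 1, .bwd 0, .bwd 1] : Word 4))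
      - 1 / 3 * wilsonExpectation (d := 4) (L := L) (fundamentalRep (Fin 3)) (β / 3) (wordLoop (fundamentalRep (Fin 3)) (0 : Site 4 L) ([.fwd 0, .fwd 1, .bwd 0, .bwd 1, .fwd 0, .fwd 1, .bwd 0, .bwd 1] : Word 4))
      + (∫ U, (fundamentalRep (Fin 3) (wordHolonomy U (0 : Site 4 L) ([.fwd 0, .fwd 1, .bwd 0, .bwd 1] : Word 4))).trace * (fundamentalRep (Fin 3) (wordHolonomy U (0 : Site 4 L) ([.fwd 0, .fwd 1, .bwd 0, .bwd 1] : Word 4))).trace ∂(wilsonMeasure (d := 4) (L := L) (fundamentalRep (Fin 3)) (β / 3))).re / 9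
      = 0 := by
  have h := su3_newton_row_plaquette (L := L) (β / 3) (0 : Site 4 L) (0 : Fin 4) 1
  simp only [Word.plaquette, List.cons_append, List.nil_append] at h
  linear_combination h

end Rung0D4SU3

end Summit.QuantumFields.GaugeBoot

end
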